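import Mathlib.CategoryTheory.Discrete.Basic
import Literature.IUT.HodgeTheaters.ThetaHodgeTheatersRemarksA2
import Literature.IUT.HodgeTheaters.ThetaHodgeTheatersRemarksB
import HarnessLib

/-!
# Schema closures (LABEL-CHECK refuters) for `KummerStructureRecoverable` (F-0424) and
# `S3Local.HolomorphicStructureObliterated` (F-0425)

PROOF-ONLY companion (cell abc-iut, block F, seat abc-iut-f-052 gen 13; abc-iut-F-lit's LABEL-CHECK list
`plan/LF-REFUTED-WITHOUT-REFUTER.tsv`, 2026-08-27T06:06Z: «a REFUTED label should name a kernel `¬∀` of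
record»), importing — never editing — `ThetaHodgeTheatersRemarksA2.lean` / `ThetaHodgeTheatersRemarksB.lean`
(S. Mochizuki, *Inter-universal Teichmüller Theory I* [IUTchI] (2012/2021), §3: Remark 3.4.2 — "the Kummer
structure `κ_v` is completely equivalent to the collection of data consisting of the Aut-holomorphic
structure … together with the co-holomorphicization", quoting [AbsTopIII] Cor 2.3; Remark 3.8.1 (iii) pp.
90–91 — a structure is obliterated by the indeterminate (full poly-) isomorphism).  Both declarations are
PARAMETRISED PREDICATES over arbitrary predicate/function parameters (plan header rule R1 (ii)/R5: a
schema's universal closure is not a fact); here the closures are FALSE by closed kernel witnesses, and the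
instance forms that DO hold are recorded next to them:
* `not_forall_kummerStructureRecoverable` — with `IsKummer := ⊤` and CONSTANT `autHolOf`, `coholOf` the
  two distinct endomorphisms `id ≠ 1` of `ℤ` are not told apart (`exists_not_kummerStructureRecoverable`);
  positive forms: `kummerStructureRecoverable_iff_injOn` (the predicate IS injectivity of
  `κ ↦ (autHolOf κ, coholOf κ)` on Kummer structures — print's "completely equivalent to"),
  `kummerStructureRecoverable_of_injective`.
* `not_forall_holomorphicStructureObliterated` — if EVERY automorphism is declared holomorphic
  (`IsHol := ⊤`) nothing is obliterated (`not_holomorphicStructureObliterated_of_forall`); positive form: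
  `holomorphicStructureObliterated_of_not_isHol` (one non-holomorphic automorphism suffices — the shape
  [AbsTopIII] §I3 supplies for `G_v`).
HONEST FRAMING: statements about OUR typed schemata (refuted-as-typed-∀ ≠ refuted-in-print); the
declarations carry `[claim: Mochizuki2012, status: disputed]` because they type sentences of [IUTchI], and
so do the theorems below — no side taken on [IUTchIII] Cor 3.12 or on any author; typed ≠ proved;
nothing here asserts abc proved or refuted.
-/

universe u v

namespace Literature.IUT.HodgeTheaters

open CategoryTheory

/-! ### F-0424 `KummerStructureRecoverable` ([IUTchI] Rmk 3.4.2) -/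

/-- Unfolding: `KummerStructureRecoverable IsKummer autHolOf coholOf` says exactly that
`κ ↦ (autHolOf κ, coholOf κ)` is INJECTIVE on the Kummer structures — the typed content of Rmk 3.4.2's
"`κ_v` is completely equivalent to the collection of data consisting of the Aut-holomorphic structure …
together with the co-holomorphicization". [claim: Mochizuki2012, status: disputed] -/
theorem kummerStructureRecoverable_iff_injOn {OC : Type u} {A : Type v} [Monoid OC] [Monoid A]
    {𝔄 ℭ : Type*} (IsKummer : (OC →* A) → Prop) (autHolOf : (OC →* A) → 𝔄)
    (coholOf : (OC →* A) → ℭ) :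
    KummerStructureRecoverable IsKummer autHolOf coholOf ↔
      Set.InjOn (fun κ => (autHolOf κ, coholOf κ)) {κ | IsKummer κ} := by
  constructor
  · intro h κ hκ κ' hκ' hpair
    exact h κ κ' hκ hκ' (Prod.mk_inj.mp hpair).1 (Prod.mk_inj.mp hpair).2
  · intro h κ κ' hκ hκ' h₁ h₂
    exact h hκ hκ' (Prod.ext h₁ h₂)

/-- Instance form that HOLDS: if the co-holomorphicization alone already determines `κ` (e.g. when
`coholOf` is injective), Kummer structures are recoverable. [claim: Mochizuki2012, status: disputed] -/
theorem kummerStructureRecoverable_of_injective {OC : Type u} {A : Type v} [Monoid OC] [Monoid A]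
    {𝔄 ℭ : Type*} (IsKummer : (OC →* A) → Prop) (autHolOf : (OC →* A) → 𝔄)
    {coholOf : (OC →* A) → ℭ} (hinj : Function.Injective coholOf) :
    KummerStructureRecoverable IsKummer autHolOf coholOf :=
  fun _ _ _ _ _ h₂ => hinj h₂

/-- **Constant-invariants witness.**  On `OC = A = ℤ` (multiplicative notation) with `IsKummer := ⊤` and
CONSTANT `autHolOf`, `coholOf`, the distinct endomorphisms `id` and `1` are not told apart: the schema
fails. [claim: Mochizuki2012, status: disputed] -/
theorem exists_not_kummerStructureRecoverable :
    ∃ (IsKummer : (Multiplicative ℤ →* Multiplicative ℤ) → Prop)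
      (autHolOf coholOf : (Multiplicative ℤ →* Multiplicative ℤ) → PUnit.{1}),
      ¬ KummerStructureRecoverable IsKummer autHolOf coholOf := by
  refine ⟨fun _ => True, fun _ => PUnit.unit, fun _ => PUnit.unit, fun h => ?_⟩
  have h1 : MonoidHom.id (Multiplicative ℤ) = 1 := h _ _ trivial trivial rfl rfl
  have h2 := DFunLike.congr_fun h1 (Multiplicative.ofAdd (1 : ℤ))
  rw [MonoidHom.id_apply, MonoidHom.one_apply, ofAdd_eq_one] at h2
  exact one_ne_zero h2

/-- **F-0424, universal closure REFUTED** (kernel `¬∀` of record for the LABEL-CHECK list): the schema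
`KummerStructureRecoverable` over ARBITRARY `IsKummer`, `autHolOf`, `coholOf` is not universally true;
consumable AT NAMED INSTANCES ONLY (the intended instance — genuine Kummer structures
`𝒪^▷(C_v) ↪ 𝒜_{D_v}` with the [AbsTopIII] Def 2.1 invariants — rests on [AbsTopIII] Cor 2.3 and the
proved `holAutUnits_eq_id_of_preservesDisc`). [claim: Mochizuki2012, status: disputed] -/
theorem not_forall_kummerStructureRecoverable :
    ¬ ∀ (OC A : Type) [Monoid OC] [Monoid A] (𝔄 ℭ : Type) (IsKummer : (OC →* A) → Prop)
        (autHolOf : (OC →* A) → 𝔄) (coholOf : (OC →* A) → ℭ),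
        Literature.IUT.HodgeTheaters.KummerStructureRecoverable IsKummer autHolOf coholOf := by
  intro h
  obtain ⟨IsKummer, autHolOf, coholOf, hne⟩ := exists_not_kummerStructureRecoverable
  exact hne (h _ _ _ _ IsKummer autHolOf coholOf)

/-! ### F-0425 `S3Local.HolomorphicStructureObliterated` ([IUTchI] Rmk 3.8.1 (iii)) -/

namespace S3Local

/-- Instance form that HOLDS: one non-holomorphic automorphism obliterates the structure under the full
poly-isomorphism (the shape [AbsTopIII] §I3 / Rmk 5.10.2 (ii) supplies for `A = G_v`).
[claim: Mochizuki2012, status: disputed] -/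
theorem holomorphicStructureObliterated_of_not_isHol {C : Type u} [Category.{v} C] {A : C}
    {IsHol : (A ≅ A) → Prop} (α : A ≅ A) (hα : ¬ IsHol α) : HolomorphicStructureObliterated A IsHol :=
  ⟨α, Set.mem_univ _, hα⟩

/-- If EVERY automorphism is holomorphic, nothing is obliterated. [claim: Mochizuki2012, status: disputed] -/
theorem not_holomorphicStructureObliterated_of_forall {C : Type u} [Category.{v} C] {A : C}
    {IsHol : (A ≅ A) → Prop} (h : ∀ α : A ≅ A, IsHol α) : ¬ HolomorphicStructureObliterated A IsHol := by
  rw [holomorphicStructureObliterated_iff, not_not]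
  exact h

/-- **F-0425, universal closure REFUTED** (kernel `¬∀` of record for the LABEL-CHECK list): the schema
`HolomorphicStructureObliterated A IsHol` over an ARBITRARY predicate `IsHol` is not universally true —
witness `IsHol := ⊤` on the one-object discrete category; consumable AT NAMED INSTANCES ONLY.
[claim: Mochizuki2012, status: disputed] -/
theorem not_forall_holomorphicStructureObliterated :
    ¬ ∀ (C : Type) [Category.{0} C] (A : C) (IsHol : (A ≅ A) → Prop),
        Literature.IUT.HodgeTheaters.S3Local.HolomorphicStructureObliterated A IsHol := fun h =>
  not_holomorphicStructureObliterated_of_forall (C := Discrete PUnit.{1}) (A := ⟨PUnit.unit⟩)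
    (IsHol := fun _ => True) (fun _ => trivial) (h _ _ _)

end S3Local

end Literature.IUT.HodgeTheaters
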